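import Summits.QuantumFields.BalabanUV.Beta.FP.CompositeOneShotJetDataSym
import Summits.QuantumFields.BalabanUV.Beta.CompositeOneShotJetsGraded

/-!
# `BalabanUV.Beta.FP.CompositeOneShotJetDataSymG` — binder row D1 ∕ (C1), σ_T AT THE ROOT OF THE L CHAIN (E-AN2-94-3 = road E-FP-73-3, journal [AN2-G94-W-16]):
# **THE FULLY-SYM RAW COMPOSITE JETS OVER THE GRADED TABLE RECORD** — S-L1 `FP.CompositeOneShotJetDataSym`'s `JNs ∕ WNs` with the ONE token `tabsComp ↦ tabsCompG`
# (PART 92 `CompositeOneShotJetsGraded.tabsCompG`: `mixFF := compMixG`, every other slot `tabsComp`'s), i.e. the typed name of SYM2's PRIMARY target Nˢʸᵐ(G) one depth up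
# (β-function cell `pub-balaban`, BINDER-OWNERS row D1 ∕ (C1) OWNER «beta-an2» gen 94, wave 3 item 1; STAGED for the director's order word on (R-b) reshaped).

WHY (located, by bytes — [AN2-G94-W-16] (I)).  The by-value certificate every L-END docstring quotes («✓ OF RECORD at (2,3), SYM2 (ii): S2 factored 1.46e−12, D₁⁺ 1.86e−12»,
`gen91/cert/sym2/SPAN-SYM2.addendum4.md` 56c550e9) is the GRADED target's — the row's own co-registration `ttrl/requests.jsonl` l.4610 registered «targets Nˢʸᵐ(G) (primary), Nˢʸᵐ(R)»
with «(G) (graded mixed)» = PART 92's record; for the UNGRADED record the same deposit prints «does not close» (S1 (c) 1.624e−2, factored B 1.822, D₁⁺ 0.130).  S-L1 types the L chain's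
jets over `tabsComp` (`tabsComp_mixFF : … = compMix`, `rfl`) — the (R) object.  The located repair σ_T is therefore ONE token at the root of the chain: the jets over `tabsCompG`.
Since the graded record differs from `tabsComp` ONLY in its `mixFF` slot (PART 92 `tabsCompG_V∕_H∕_vh₂S_eq_tabsComp_…`), the FIRST-ORDER stencils and hence the L-family `VNs` are
UNCHANGED (`JNsG_S_eq_JNs_S`, `rfl`): σ_T moves only the second-order family, `WNs ↦ WNsG`.  Downstream (road, by its generator): S-L3a∕S-L3b∕annex∕S-END re-typed at
`(VNs, WNsG)`, displaying `hlawL_G : hessKer (ANs …) (VNs …) (WNsG …) a b z = …`, whose (R4)(ii) by-value clause is then TRUE as worded.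

WHAT ([our object — bookkeeping] two `def`s + [folklore] letters BY NAME over an2's generic `ChartStepJets` (LW)(Wt); no `def … : Prop`, nothing cited, 0 sorry):
§1 **`JNsG R Ψs hΨ P j := JsChart0Of (fun _ => ANs R Ψs j) (fun _ => decays_ANs …) (tabsCompG (j+1) … (P.cM (j+1))) (P.cE …) (P.cVH …) (P.cΛ …) (P.cE₂ …) (P.cB …) (P.T …) 0`**,
**`WNsG := (JNsG …).W`**, unfoldings `JNsG_S ∕ JNsG_W ∕ WNsG_eq` (`rfl`), **`JNsG_S_eq_JNs_S`** (`rfl`: the graded record's first-order slots are `tabsComp`'s, so `VNs` serves both chains),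
`vertexOfK_JNsG_S_eq_VNs` (`rfl`); §2 the letters at the graded jets: **`vertexFamily₂_WNsG`** (LW), **`vertexFamilies_VNs_WNsG`** (one common rate with S-L1 `vertexFamily_VNs`),
**`WNsG_translate`** (Wt, ⟸ `hΨt`), **`loc_WNsG`**.
WHAT THIS IS NOT: not `hlawL_G` (THE CRUX, graded — OPEN by name, displayed downstream by the road), not S-L3a∕S-L3b∕S-END-G (road items, (R-b)), not a by-value claim at (4,3); the
ungraded S-L1 objects are untouched and remain the (II)-controlled twins of the record (`JNs_psiK`); nothing of Bałaban's asserted, valued or discharged; 0 estimates; 0∕4 row-D1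
binders (hW, hR, D1Tel, D1Rep); NOT (C1), NOT (T-ID), NOT D1, NEVER «G-an2-4 closed», NOT BetaPertH, NOT continuum, NOT Clay.

HONEST DEPENDENCY (page 1, mandatory): continuum YM on T⁴ ⇐ BetaPertH ∧ nine spine estimates (0/9 proved); BetaPertH ⇐ (D1) ∧ (D4) ∧ CAP+tail;
G-an2-4 gates asym, D1 and NE2/3/4.  HONEST FRAMING (cell contract, verbatim): «discharging `BetaPertH` makes Bałaban's UV stability UNCONDITIONAL —
a real constructive-QFT result; it is NOT the continuum limit and NOT the Clay problem.»  ABSOLUTE RULE (cell charter, verbatim): «No internally-minted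
statement may enter as a cited fact. Every hypothesis is either kernel-proved in this package or a verbatim quotation of a PUBLISHED theorem with page
reference. The manuscript(s) under audit are NOT citable for their own disputed steps — they are the thing under adjudication; programme-internal
(2001/route/tribunal) claims are never citable.»  Row D1 ∕ (C1) OWNER «beta-an2» gen 94, 2026-08-31.  No existing file touched.
-/

noncomputable section

open scoped BigOperators

namespace Summit.QuantumFields.BalabanUV.Beta.FP.CompositeOneShotJetDataSymG

open Finset
open Literature.MathematicalPhysics.QuantumFieldTheory
open Literature.MathematicalPhysics.QuantumFieldTheory.Balaban1983to89
open Literature.MathematicalPhysics.QuantumFieldTheory.Balaban1983to89.Beta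
open AffineAveraging (Site box toSite)
open ExpKernelCalculus (MKer Decays BiLoc VertexFamily VertexFamily₂ shiftK)
open OneStepResolventKernel (Fib JetData LocStencil biLoc_mono)
open OneStepKernelFamily (vertexOfK)
open BalabanStepJets (vertexFamily₂_mono)
open Summit.QuantumFields.BalabanUV.Beta.TameKernelCalculus (Spr Loc)
open Summit.QuantumFields.BalabanUV.Beta.AxialDressingRooted (one_le_of_neZero)
open Summit.QuantumFields.BalabanUV.Beta.ChartStepJets (JsChart0Of JsChart0Of_S JsChart0Of_W JsChart0Of_W_translate vertexFamily₂_WchartOf)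
open Summit.QuantumFields.BalabanUV.Beta.CompositeOneShotJets (tabsComp)
open Summit.QuantumFields.BalabanUV.Beta.CompositeOneShotJetsGraded (tabsCompG)
open Summit.QuantumFields.BalabanUV.Beta.CompositeOneShotJetData (Roots Pins)
open Summit.QuantumFields.BalabanUV.Beta.GAN24.WSlotParityBlind (loc_of_vertexFamily₂)
open Summit.QuantumFields.BalabanUV.Beta.FP.CompositeOneShotJetDataSym (ANs decays_ANs shiftK_ANs JNs VNs VNs_eq vertexFamily_VNs)

/-! ## §1 The graded fully-sym jets and their second-order family -/

section Objects

variable {Lc : ℕ} [NeZero Lc] (R : Roots Lc) (Ψs : ℕ → MKer (3 + 1) (Fib 3)) (hΨ : ∀ m, Spr (Ψs m)) (P : Pins)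

/-- [our object — bookkeeping] **`JNsG` — THE FULLY-SYM RAW COMPOSITE JETS at depth `j+1` OVER THE GRADED TABLE RECORD**: S-L1 `JNs`'s body with `tabsComp ↦ tabsCompG`
(PART 92; `mixFF := compMixG`), chart family `fun _ => ANs R Ψs j`, pins `P.c• (j+1)` untouched. -/
def JNsG (j : ℕ) : JetData 3 (Lc ^ (j + 1)) :=
  JsChart0Of (fun _ => ANs R Ψs j) (fun _ => decays_ANs R Ψs hΨ j) (tabsCompG (j + 1) (one_le_of_neZero Lc) R.hr (P.cM (j + 1)))
    (P.cE (j + 1)) (P.cVH (j + 1)) (P.cΛ (j + 1)) (P.cE₂ (j + 1)) (P.cB (j + 1)) (P.T (j + 1)) 0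

/-- [our object — bookkeeping] **`WNsG`** — the second-order family UNDER L at the graded fully-sym jets: `(JNsG j).W`. -/
def WNsG (j : ℕ) : Fin (3 + 1) → Site (3 + 1) → Fin (3 + 1) → Site (3 + 1) → MKer (3 + 1) (Fib 3) :=
  (JNsG R Ψs hΨ P j).W

/-- `WNsG` unfolded (`rfl`). -/
theorem WNsG_eq (j : ℕ) : WNsG R Ψs hΨ P j = (JNsG R Ψs hΨ P j).W := rfl

/-- the first-order stencils of the graded sym jets (`rfl` through `JsChart0Of_S`). -/
theorem JNsG_S (j : ℕ) : (JNsG R Ψs hΨ P j).S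
    = ChartStepJets.SchartOf (fun _ => ANs R Ψs j) (tabsCompG (j + 1) (one_le_of_neZero Lc) R.hr (P.cM (j + 1))) (P.cE (j + 1)) (P.cVH (j + 1)) (P.cΛ (j + 1)) 0 := rfl

/-- the second-order family of the graded sym jets (`rfl` through `JsChart0Of_W`). -/
theorem JNsG_W (j : ℕ) : (JNsG R Ψs hΨ P j).W
    = ChartStepJets.WchartOf (fun _ => ANs R Ψs j) (tabsCompG (j + 1) (one_le_of_neZero Lc) R.hr (P.cM (j + 1)))
        (P.cE (j + 1)) (P.cVH (j + 1)) (P.cΛ (j + 1)) (P.cE₂ (j + 1)) (P.cB (j + 1)) (P.T (j + 1)) 0 := rfl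

/-- [folklore] **`JNsG_S_eq_JNs_S` — σ_T DOES NOT MOVE THE FIRST-ORDER STENCILS** (`rfl`): the graded record's `V ∕ H ∕ M` slots are `tabsComp`'s (PART 92), and the first-order stencils
read no mixed table — so S-L1's L-family `VNs` serves the graded chain unchanged. -/
theorem JNsG_S_eq_JNs_S (j : ℕ) : (JNsG R Ψs hΨ P j).S = (JNs R Ψs hΨ P j).S := rfl

/-- [folklore] (`rfl`) the L-family over the graded stencils IS S-L1's `VNs`. -/
theorem vertexOfK_JNsG_S_eq_VNs (j : ℕ) : vertexOfK (ANs R Ψs j) (Lc ^ (j + 1)) (JNsG R Ψs hΨ P j).S = VNs R Ψs hΨ P j := rfl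

end Objects

/-! ## §2 The jet letters at the graded fully-sym jets (an2 `ChartStepJets`' generic (LW)(Wt)) -/

section Letters

variable {Lc : ℕ} [NeZero Lc] (R : Roots Lc) (Ψs : ℕ → MKer (3 + 1) (Fib 3)) (hΨ : ∀ m, Spr (Ψs m)) (P : Pins)

/-- [folklore] (LW) at the graded sym jets: the second-order family is a second-order vertex family (⟸ `hΨ`; S-L1 `vertexFamily₂_WNs` one token over). -/
theorem vertexFamily₂_WNsG (j : ℕ) : ∃ Cw δw : ℝ, 0 < δw ∧ VertexFamily₂ (WNsG R Ψs hΨ P j) (Lc ^ (j + 1)) Cw δw := by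
  rw [WNsG_eq, JNsG_W]
  exact vertexFamily₂_WchartOf (G := fun _ => ANs R Ψs j)
    (tabsCompG (j + 1) (one_le_of_neZero Lc) R.hr (P.cM (j + 1))) (P.cE (j + 1)) (P.cVH (j + 1)) (P.cΛ (j + 1)) (P.cE₂ (j + 1)) (P.cB (j + 1))
    (P.T (j + 1)) (fun _ => decays_ANs R Ψs hΨ j) 0

/-- [folklore] **`vertexFamilies_VNs_WNsG`** — the two families of the GRADED L chain at one common rate (S-L1 `vertexFamily_VNs` + §2 (LW)). -/
theorem vertexFamilies_VNs_WNsG (j : ℕ) :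
    ∃ Cv Cw δ : ℝ, 0 < δ ∧ VertexFamily (VNs R Ψs hΨ P j) (Lc ^ (j + 1)) Cv δ ∧ VertexFamily₂ (WNsG R Ψs hΨ P j) (Lc ^ (j + 1)) Cw δ := by
  obtain ⟨Cv, δv, hδv, hV⟩ := vertexFamily_VNs R Ψs hΨ P j
  obtain ⟨Cw, δw, hδw, hW⟩ := vertexFamily₂_WNsG R Ψs hΨ P j
  have hCv : 0 ≤ Cv := (hV 0 0).nonneg (Sum.inl 0)
  have hCw : 0 ≤ Cw := (hW 0 0 0 0).nonneg (Sum.inl 0)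
  exact ⟨Cv, Cw, min δv δw, lt_min hδv hδw, fun μ y => biLoc_mono (hV μ y) hCv (min_le_left _ _),
    vertexFamily₂_mono hW hCw (min_le_right _ _)⟩

/-- [folklore] **`WNsG_translate`** — joint block covariance of the graded second-order family ((Wt) `JsChart0Of_W_translate` ⟸ `hΨt`; S-L1 `WNs_translate` one token over). -/
theorem WNsG_translate (j : ℕ) (hΨt : ∀ t : Site (3 + 1), shiftK (-(((Lc ^ (j + 1) : ℕ) : ℤ) • t)) (Ψs (j + 1)) = Ψs (j + 1))
    (c : Fin (3 + 1)) (t : Fin (3 + 1) → ℤ) (e : Fin (3 + 1)) (t' s : Fin (3 + 1) → ℤ) :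
    WNsG R Ψs hΨ P j c (t + s) e (t' + s) = shiftK (-(((Lc ^ (j + 1) : ℕ) : ℤ) • s)) (WNsG R Ψs hΨ P j c t e t') := by
  rw [WNsG_eq]
  exact JsChart0Of_W_translate (fun _ => ANs R Ψs j) (fun _ => decays_ANs R Ψs hΨ j)
    (tabsCompG (j + 1) (one_le_of_neZero Lc) R.hr (P.cM (j + 1))) (P.cE (j + 1)) (P.cVH (j + 1)) (P.cΛ (j + 1)) (P.cE₂ (j + 1)) (P.cB (j + 1)) (P.T (j + 1))
    (fun _ t'' => shiftK_ANs R Ψs j hΨt t'') 0 c t e t' s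

/-- [folklore] **`loc_WNsG`** — every member of the graded fully-sym second-order family is LOCALISED ((LW) + `WSlotParityBlind.loc_of_vertexFamily₂`). -/
theorem loc_WNsG (j : ℕ) (μ : Fin (3 + 1)) (y : Site (3 + 1)) (ν : Fin (3 + 1)) (y' : Site (3 + 1)) : Loc (WNsG R Ψs hΨ P j μ y ν y') := by
  obtain ⟨Cw, δw, hδw, hW⟩ := vertexFamily₂_WNsG R Ψs hΨ P j
  exact loc_of_vertexFamily₂ hW hδw μ y ν y'

end Letters

/-! ## §3 The road's S-L1-G names (road FP g73 A-13 xread `xread-g73-CompositeOneShotJetDataSymG` 343926a1, typed independently in the same hour) — appended so that the road's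
S-L3b-G `StepRecursionSymEndG` ∕ annex-G elaborate against THIS tree module unchanged (gen-94 append [AN2-G94-W-18]); `VNsG` is `VNs` by `rfl` (§1 `JNsG_S_eq_JNs_S`). -/

section RoadNames

open Summit.QuantumFields.BalabanUV.Beta.CompositeOneShotJetData (JNat)
open Summit.QuantumFields.BalabanUV.Beta.FP.CompositeOneShotJetDataSym (locStencil_JNs_S VNs_translate)

variable {Lc : ℕ} [NeZero Lc] (R : Roots Lc) (Ψs : ℕ → MKer (3 + 1) (Fib 3)) (hΨ : ∀ m, Spr (Ψs m)) (P : Pins)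

/-- [our object — bookkeeping] **`VNsG`** — the first-order family UNDER L at the graded fully-sym jets: `vertexOfK (ANs j) (Lc^(j+1)) (JNsG j).S` (the road's display name; = S-L1 `VNs`, `rfl`). -/
def VNsG (j : ℕ) : Fin (3 + 1) → Site (3 + 1) → MKer (3 + 1) (Fib 3) :=
  vertexOfK (ANs R Ψs j) (Lc ^ (j + 1)) (JNsG R Ψs hΨ P j).S

/-- `VNsG` unfolded (`rfl`). -/
theorem VNsG_eq (j : ℕ) : VNsG R Ψs hΨ P j = vertexOfK (ANs R Ψs j) (Lc ^ (j + 1)) (JNsG R Ψs hΨ P j).S := rfl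

/-- [folklore] **`VNsG_eq_VNs`** (`rfl`): grading is first-order-blind — the graded L-family IS S-L1's `VNs`. -/
theorem VNsG_eq_VNs (j : ℕ) : VNsG R Ψs hΨ P j = VNs R Ψs hΨ P j := rfl

/-- [folklore] (LS) at the graded sym jets (S-L1 `locStencil_JNs_S` through §1's `rfl`). -/
theorem locStencil_JNsG_S (j : ℕ) : ∃ Cs δs : ℝ, 0 < δs ∧ LocStencil (JNsG R Ψs hΨ P j).S Cs δs :=
  locStencil_JNs_S R Ψs hΨ P j

/-- [folklore] the graded L-family is a vertex family (S-L1 `vertexFamily_VNs`). -/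
theorem vertexFamily_VNsG (j : ℕ) : ∃ Cv δv : ℝ, 0 < δv ∧ VertexFamily (VNsG R Ψs hΨ P j) (Lc ^ (j + 1)) Cv δv :=
  vertexFamily_VNs R Ψs hΨ P j

/-- [folklore] the two graded families at one common rate (§2 `vertexFamilies_VNs_WNsG`, road's name). -/
theorem vertexFamilies_VNsG_WNsG (j : ℕ) :
    ∃ Cv Cw δ : ℝ, 0 < δ ∧ VertexFamily (VNsG R Ψs hΨ P j) (Lc ^ (j + 1)) Cv δ ∧ VertexFamily₂ (WNsG R Ψs hΨ P j) (Lc ^ (j + 1)) Cw δ :=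
  vertexFamilies_VNs_WNsG R Ψs hΨ P j

/-- [folklore] block covariance of the graded L-family (S-L1 `VNs_translate`, ⟸ `hΨt`). -/
theorem VNsG_translate (j : ℕ) (hΨt : ∀ t : Site (3 + 1), shiftK (-(((Lc ^ (j + 1) : ℕ) : ℤ) • t)) (Ψs (j + 1)) = Ψs (j + 1))
    (c : Fin (3 + 1)) (t s : Fin (3 + 1) → ℤ) :
    VNsG R Ψs hΨ P j c (t + s) = shiftK (-(((Lc ^ (j + 1) : ℕ) : ℤ) • s)) (VNsG R Ψs hΨ P j c t) :=
  VNs_translate R Ψs hΨ P j hΨt c t s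

/-- [folklore] **`JNsG_S_eq_JNat_S`** (`rfl`): the first-order stencils of the graded fully-sym jets ARE the record's. -/
theorem JNsG_S_eq_JNat_S (j : ℕ) : (JNsG R Ψs hΨ P j).S = (JNat R P (j + 1)).S := rfl

/-- [folklore] **`VNsG_eq_vertexOfK_JNat`** (`rfl`): the graded L-family is the L-chart's ℋ-column over the RECORD stencils. -/
theorem VNsG_eq_vertexOfK_JNat (j : ℕ) : VNsG R Ψs hΨ P j = vertexOfK (ANs R Ψs j) (Lc ^ (j + 1)) (JNat R P (j + 1)).S := rfl

end RoadNames

end Summit.QuantumFields.BalabanUV.Beta.FP.CompositeOneShotJetDataSymG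

end
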